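import Summits.CriticalPhenomena.PercolationContinuityZ3.Theorems.PercNearOneGluingNoHeavyQuantLawDEC
import HarnessLib

/-!
# QUANT lane R8, T-DEC: law-level DEC(j′) CRITERIA for any number of blobs — GIANT ABSORPTION at a common gate plus a
# decomposition of the remainder (self-sufficient atoms, or Theorem A under a MEAN CONDITION)

builds on p205010 (kernel theorem, internal audit signed; external expert review pending)

Support file (`--supports stmt-CriticalPhenomena-4575`), QUANT lane seat prim-quant-census-2 (gen 52), rung R8 of
`run/shared/lean/prim/quant/LADDER.md`.  Memo `run/shared/lean/prim/quant/prim-quant-census-2-g52/DEC-CRITERIA-G52.md` (criteria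
E / C′ and their census: on heavy blob systems they certify DEC(j′) in all but a thin high-floor family).  Theorems only.

THE CRITERIA (law `μ` on `{0..M}`, mean `T`, floor `x`, layer `j′ < M`; giants `h ≥ j′+1` with mass `P_G`).
* `LawDec.decAt_of_absorb` (CORE).  An ABSORPTION DATUM is `f ≤ μ` on `{0..j′}` and a gate `ḡ ∈ [x, 1)` with the balance
  `ḡ·Σ_{h ≤ j′} f h = (1 − ḡ)·P_G`: the giant-heavy pairs `{ℓ, h; ḡ}` with weights `f ℓ·μ h/((1−ḡ)P_G)` carry exactly the giant
  mass and the absorbed mass `f` (rule (G), valid whatever the credit).  If the REMAINDER `ν = (μ − f)·1_{≤ j′}` is an exact mixture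
  of components valid at `(x, T, j′)`, then `μ` is DEC(j′) (`Quant.LawDec.DECAt`).
* `LawDec.rest_of_selfSufficient` — remainder data when every charged atom of `ν` is self-sufficient (`2h ≥ T`): point masses.
  With `f = μ` on the low atoms and `ḡ = P_G/(P_G + P_low) ≥ x` this is CRITERION E ("giants absorb all lows", DEC-TAMP-G50 §3.7
  step (1) = the inequality `G(j′)`).
* `LawDec.rest_of_meanCondition` — CRITERION C′: if the charged atoms of `ν` lie in `[ℓ*, h*]` and its mean is at least
  `(T − σ)·mass(ν)` with `0 ≤ σ ≤ ℓ*`, `2σ ≤ T`, `σ ≤ ℓ*(1−x)² + x(T − x·h*)`, then Theorem A's mean-exact decomposition of `ν`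
  (`exists_twoPoint_decomposition`) consists of components valid at target `T`: point mass `m ≥ T − σ ≥ T/2`; heavy pair: credit
  `lo + m ≥ ℓ* + T − σ ≥ T`; light pair: credit `≥ T ⟺ T − m ≤ lo(1−x)² + x(T − x·hi)`.
Census (heavy blob systems, floor = least gate, every window layer with no single-blob giant; exact rationals; memo §2): E ∨ C′ with
`ḡ = x` and `f` = "the smallest atoms first" certifies 25 031 / 25 032 (k ≤ 3, gates k/8, sizes ≤ 4) and 184 543 / 184 550 (k ≤ 3,
gates k/12, sizes ≤ 5) instances; every exception has floor ≥ 5/6 (kit census in the memo).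

[this work]; DEC rules ARCH-TREES-G49 §2.2 / DEC-TAMP-G50 §3.1, Theorem A DEC-TAMP-G50 §1 (this lane).  The gluing rows served
[cite: KozmaNitzan2024, Conjecture 3 (p. 15)]; product measure [cite: Grimmett1999, §1.3 p. 10].
-/

noncomputable section

namespace Summit.CriticalPhenomena.PercolationContinuityZ3.Theorems

namespace Quant

open Finset

/-- the two-point law `{lo, hi; g}` (as in `…QuantLawDEC`) -/
local notation3 "TP[" lo ", " hi ", " g ", " h "]" =>
  (g : ℝ) * (if (h : ℕ) = (hi : ℕ) then (1 : ℝ) else 0) + (1 - (g : ℝ)) * (if (h : ℕ) = (lo : ℕ) then (1 : ℝ) else 0)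

namespace LawDec

/-! ### Bookkeeping sums -/

/-- `Σ_{i < n} u(m+i)·[t = m+i] = u t` if `m ≤ t < m + n`, else `0`. [folklore] -/
theorem sum_shift_indicator (u : ℕ → ℝ) (m n t : ℕ) :
    ∑ i ∈ Finset.range n, u (m + i) * (if t = m + i then (1 : ℝ) else 0) =
      if m ≤ t ∧ t < m + n then u t else 0 := by
  split_ifs with ht
  · rw [Finset.sum_eq_single (t - m)]
    · have e : m + (t - m) = t := by omega
      rw [e, if_pos rfl, mul_one]
    · intro i _ hi
      rw [if_neg (by omega), mul_zero]
    · intro hn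
      exfalso; exact hn (Finset.mem_range.2 (by omega))
  · refine Finset.sum_eq_zero fun i hi => ?_
    rw [Finset.mem_range] at hi
    rw [if_neg (by omega), mul_zero]

/-- `Σ_{ℓ < n} u ℓ·[t = ℓ] = u t` if `t < n`, else `0`. [folklore] -/
theorem sum_indicator (u : ℕ → ℝ) (n t : ℕ) :
    ∑ l ∈ Finset.range n, u l * (if t = l then (1 : ℝ) else 0) = if t < n then u t else 0 := by
  have h := sum_shift_indicator u 0 n t
  simp only [zero_add, zero_le, true_and] at h
  exact h

/-! ### CORE: giant absorption at a common gate plus a decomposed remainder -/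

/-- **DEC(j′) FROM AN ABSORPTION DATUM AND A DECOMPOSED REMAINDER.**  Law `μ ≥ 0` on `{0..M}` (mass `1`), floor `x`, layer
`j′ < M`, a gate `ḡ ∈ [x,1)` with `0 < ḡ`, absorbed masses `0 ≤ f ≤ μ` with the balance `ḡ·Σ_{h ≤ j′} f h = (1−ḡ)·Σ_{j′ < h ≤ M} μ h`,
and an exact mixture of components valid at `(x, T, j′)` (`T` the mean of `μ`) for the remainder `(μ − f)·1_{≤ j′}`.  Then
`Quant.LawDec.DECAt x j′ M μ`: the witness is the giant-heavy pairs `{ℓ, j′+1+i; ḡ}` with weights `f ℓ·μ(j′+1+i)/((1−ḡ)·P_G)` next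
to the remainder's components. [this work] -/
theorem decAt_of_absorb (x gbar : ℝ) (j' M : ℕ) (μ f : ℕ → ℝ) (hjM : j' < M)
    (hμ0 : ∀ h, 0 ≤ μ h) (hμM : ∀ h, M < h → μ h = 0) (hμ1 : ∑ h ∈ Finset.range (M + 1), μ h = 1)
    (hxg : x ≤ gbar) (hg0 : 0 < gbar) (hg1 : gbar < 1)
    (hf0 : ∀ h, 0 ≤ f h)
    (hbal : gbar * ∑ h ∈ Finset.range (j' + 1), f h = (1 - gbar) * ∑ h ∈ Finset.Ico (j' + 1) (M + 1), μ h)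
    (hrest : ∃ (ρ : Type) (_ : Fintype ρ) (lam g : ρ → ℝ) (lo hi : ρ → ℕ),
      (∀ r, 0 ≤ lam r) ∧ (∑ r, lam r = ∑ h ∈ Finset.range (j' + 1), (μ h - f h)) ∧ (∀ r, 0 ≤ g r ∧ g r ≤ 1) ∧
      (∀ r, lo r ≤ hi r) ∧ (∀ r, hi r ≤ j') ∧
      (∀ h, (if h ≤ j' then μ h - f h else 0) = ∑ r, lam r * TP[lo r, hi r, g r, h]) ∧
      (∀ r, 0 < lam r → ValidAt x (∑ h ∈ Finset.range (M + 1), (h : ℝ) * μ h) j' (lo r) (hi r) (g r))) :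
    DECAt x j' M μ := by
  classical
  obtain ⟨ρ, hρ, lam, g, lo, hi, hlam0, hlamsum, hg, hlohi, hhi, hmix, hval⟩ := hrest
  -- names
  obtain ⟨PG, hPG⟩ : ∃ P : ℝ, P = ∑ h ∈ Finset.Ico (j' + 1) (M + 1), μ h := ⟨_, rfl⟩
  obtain ⟨F, hF⟩ : ∃ F : ℝ, F = ∑ h ∈ Finset.range (j' + 1), f h := ⟨_, rfl⟩
  obtain ⟨K, hK⟩ : ∃ K : ℝ, K = (1 - gbar) * PG := ⟨_, rfl⟩
  rw [← hPG, ← hF] at hbal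
  have hPG0 : 0 ≤ PG := by rw [hPG]; exact Finset.sum_nonneg fun h _ => hμ0 h
  have hK0 : 0 ≤ K := by rw [hK]; exact mul_nonneg (by linarith) hPG0
  have hF0 : 0 ≤ F := by rw [hF]; exact Finset.sum_nonneg fun h _ => hf0 h
  -- the split of the total mass
  have hsplit : ∑ h ∈ Finset.range (j' + 1), μ h + PG = 1 := by
    rw [hPG, Finset.range_eq_Ico, Finset.sum_Ico_consecutive _ (Nat.zero_le _) (by omega), ← Finset.range_eq_Ico, hμ1]
  -- if `K = 0` there are no giants and nothing is absorbed
  have hKF : K = 0 → PG = 0 ∧ F = 0 := by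
    intro hK0'
    have hPG' : PG = 0 := by
      rcases mul_eq_zero.1 (hK ▸ hK0' : (1 - gbar) * PG = 0) with h | h
      · exfalso; linarith
      · exact h
    refine ⟨hPG', ?_⟩
    have : gbar * F = 0 := by rw [hbal, hPG', mul_zero]
    rcases mul_eq_zero.1 this with h | h
    · exfalso; linarith
    · exact h
  have hf_zero_of : F = 0 → ∀ h, h ≤ j' → f h = 0 := by
    intro hF0' h hh
    have := (Finset.sum_eq_zero_iff_of_nonneg (fun l _ => hf0 l)).1 (hF ▸ hF0' : ∑ h ∈ Finset.range (j' + 1), f h = 0)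
      h (Finset.mem_range.2 (Nat.lt_succ_of_le hh))
    exact this
  have hμ_zero_of : PG = 0 → ∀ h, j' + 1 ≤ h → μ h = 0 := by
    intro hPG' h hh
    by_cases hM : h ≤ M
    · exact (Finset.sum_eq_zero_iff_of_nonneg (fun l _ => hμ0 l)).1
        (hPG ▸ hPG' : ∑ h ∈ Finset.Ico (j' + 1) (M + 1), μ h = 0) h (Finset.mem_Ico.2 ⟨hh, Nat.lt_succ_of_le hM⟩)
    · exact hμM h (not_le.1 hM)
  -- the witness
  refine ⟨(Fin (j' + 1) × Fin (M - j')) ⊕ ρ, inferInstance,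
    Sum.elim (fun p => f p.1 * μ (j' + 1 + p.2) / K) lam, Sum.elim (fun _ => gbar) g,
    Sum.elim (fun p => (p.1 : ℕ)) lo, Sum.elim (fun p => j' + 1 + (p.2 : ℕ)) hi, ?_, ?_, ?_, ?_, ?_, ?_, ?_⟩
  · -- nonnegativity
    rintro (p | r)
    · exact div_nonneg (mul_nonneg (hf0 _) (hμ0 _)) hK0
    · exact hlam0 r
  · -- total weight
    rw [Fintype.sum_sum_type]
    dsimp only [Sum.elim_inl, Sum.elim_inr]
    rw [hlamsum, Fintype.sum_prod_type]
    have e0 : ∑ p₁ : Fin (j' + 1), ∑ p₂ : Fin (M - j'), f (p₁ : ℕ) * μ (j' + 1 + (p₂ : ℕ)) / K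
        = ∑ l ∈ Finset.range (j' + 1), ∑ i ∈ Finset.range (M - j'), f l * μ (j' + 1 + i) / K := by
      rw [Fin.sum_univ_eq_sum_range (fun l => ∑ p₂ : Fin (M - j'), f l * μ (j' + 1 + (p₂ : ℕ)) / K) (j' + 1)]
      refine Finset.sum_congr rfl fun l _ => ?_
      exact Fin.sum_univ_eq_sum_range (fun i => f l * μ (j' + 1 + i) / K) (M - j')
    have e1 : ∑ p₁ : Fin (j' + 1), ∑ p₂ : Fin (M - j'), f (p₁ : ℕ) * μ (j' + 1 + (p₂ : ℕ)) / K
        = (∑ l ∈ Finset.range (j' + 1), f l) * (∑ i ∈ Finset.range (M - j'), μ (j' + 1 + i)) / K := by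
      rw [e0, Finset.sum_mul_sum, Finset.sum_div]
      refine Finset.sum_congr rfl fun l _ => ?_
      rw [Finset.sum_div]
    have e2 : ∑ i ∈ Finset.range (M - j'), μ (j' + 1 + i) = PG := by
      rw [hPG, Finset.sum_Ico_eq_sum_range]
      have : M + 1 - (j' + 1) = M - j' := by omega
      rw [this]
    rw [e1, e2, ← hF, Finset.sum_sub_distrib, ← hF]
    rcases hK0.eq_or_lt with hK0' | hKpos
    · obtain ⟨hPG', hF'⟩ := hKF hK0'.symm
      rw [← hK0', div_zero, hF', zero_add, sub_zero]
      linarith [hsplit]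
    · have hK' : F * PG / K = F + PG := by
        rw [div_eq_iff hKpos.ne', hK]
        have : gbar * F = (1 - gbar) * PG := hbal
        nlinarith [this]
      rw [hK']
      linarith [hsplit]
  · -- gates in [0,1]
    rintro (p | r)
    · exact ⟨hg0.le, hg1.le⟩
    · exact hg r
  · -- lo ≤ hi
    rintro (p | r)
    · dsimp only [Sum.elim_inl]
      have := p.1.isLt
      omega
    · exact hlohi r
  · -- hi ≤ M
    rintro (p | r)
    · dsimp only [Sum.elim_inl]
      have := p.2.isLt
      omega
    · exact (hhi r).trans hjM.le
  · -- the mixture identity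
    intro t
    rw [Fintype.sum_sum_type]
    show μ t = (∑ p : Fin (j' + 1) × Fin (M - j'),
        f (p.1 : ℕ) * μ (j' + 1 + (p.2 : ℕ)) / K * TP[(p.1 : ℕ), j' + 1 + (p.2 : ℕ), gbar, t]) +
      ∑ r, lam r * TP[lo r, hi r, g r, t]
    rw [← hmix t, Fintype.sum_prod_type]
    -- the giant pairs: rewrite as range sums and split
    have e1a : ∑ p₁ : Fin (j' + 1), ∑ p₂ : Fin (M - j'),
        f (p₁ : ℕ) * μ (j' + 1 + (p₂ : ℕ)) / K * TP[(p₁ : ℕ), j' + 1 + (p₂ : ℕ), gbar, t]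
        = ∑ l ∈ Finset.range (j' + 1), ∑ i ∈ Finset.range (M - j'),
            f l * μ (j' + 1 + i) / K * TP[l, j' + 1 + i, gbar, t] := by
      rw [Fin.sum_univ_eq_sum_range (fun l => ∑ p₂ : Fin (M - j'),
            f l * μ (j' + 1 + (p₂ : ℕ)) / K * TP[l, j' + 1 + (p₂ : ℕ), gbar, t]) (j' + 1)]
      refine Finset.sum_congr rfl fun l _ => ?_
      exact Fin.sum_univ_eq_sum_range (fun i => f l * μ (j' + 1 + i) / K * TP[l, j' + 1 + i, gbar, t]) (M - j')
    have e1 : ∑ l ∈ Finset.range (j' + 1), ∑ i ∈ Finset.range (M - j'),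
            f l * μ (j' + 1 + i) / K * TP[l, j' + 1 + i, gbar, t]
        = ∑ l ∈ Finset.range (j' + 1), ∑ i ∈ Finset.range (M - j'),
            ((gbar / K) * (f l * (μ (j' + 1 + i) * (if t = j' + 1 + i then (1 : ℝ) else 0)))
              + ((1 - gbar) / K) * ((f l * (if t = l then (1 : ℝ) else 0)) * μ (j' + 1 + i))) := by
      refine Finset.sum_congr rfl fun l _ => Finset.sum_congr rfl fun i _ => ?_
      ring
    have e2 : ∑ l ∈ Finset.range (j' + 1), ∑ i ∈ Finset.range (M - j'),
        gbar / K * (f l * (μ (j' + 1 + i) * (if t = j' + 1 + i then (1 : ℝ) else 0)))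
        = gbar / K * (F * (if j' + 1 ≤ t ∧ t < j' + 1 + (M - j') then μ t else 0)) := by
      rw [← sum_shift_indicator μ (j' + 1) (M - j') t, hF, Finset.sum_mul_sum, Finset.mul_sum]
      refine Finset.sum_congr rfl fun l _ => ?_
      rw [Finset.mul_sum]
    have e3 : ∑ l ∈ Finset.range (j' + 1), ∑ i ∈ Finset.range (M - j'),
        (1 - gbar) / K * ((f l * (if t = l then (1 : ℝ) else 0)) * μ (j' + 1 + i))
        = (1 - gbar) / K * ((if t < j' + 1 then f t else 0) * PG) := by
      rw [← sum_indicator f (j' + 1) t, hPG, Finset.sum_Ico_eq_sum_range,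
        show M + 1 - (j' + 1) = M - j' by omega, Finset.sum_mul_sum, Finset.mul_sum]
      refine Finset.sum_congr rfl fun l _ => ?_
      rw [Finset.mul_sum]
    rw [e1a, e1]
    simp only [Finset.sum_add_distrib]
    rw [e2, e3]
    -- case analysis on K
    rcases hK0.eq_or_lt with hK0' | hKpos
    · obtain ⟨hPG', hF'⟩ := hKF hK0'.symm
      rw [← hK0', div_zero, div_zero, zero_mul, zero_mul, zero_add, zero_add]
      by_cases ht : t ≤ j'
      · rw [if_pos ht, hf_zero_of hF' t ht, sub_zero]
      · rw [if_neg ht]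
        exact hμ_zero_of hPG' t (by omega)
    · have hKne : K ≠ 0 := hKpos.ne'
      have c1 : gbar / K * F = 1 := by
        rw [div_mul_eq_mul_div, div_eq_one_iff_eq hKne, hK]; exact hbal
      have c2 : (1 - gbar) / K * PG = 1 := by
        rw [div_mul_eq_mul_div, div_eq_one_iff_eq hKne, hK]
      have lhs1 : gbar / K * (F * (if j' + 1 ≤ t ∧ t < j' + 1 + (M - j') then μ t else 0))
          = (if j' + 1 ≤ t ∧ t < j' + 1 + (M - j') then μ t else 0) := by
        rw [← mul_assoc, c1, one_mul]
      have lhs2 : (1 - gbar) / K * ((if t < j' + 1 then f t else 0) * PG) = (if t < j' + 1 then f t else 0) := by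
        rw [mul_comm ((if t < j' + 1 then f t else 0)) PG, ← mul_assoc, c2, one_mul]
      rw [lhs1, lhs2]
      by_cases ht : t ≤ j'
      · rw [if_neg (by omega), if_pos (Nat.lt_succ_of_le ht), if_pos ht]; ring
      · rw [if_neg (by omega : ¬ t < j' + 1), if_neg ht, add_zero, add_zero]
        by_cases htM : t ≤ M
        · rw [if_pos (by omega)]
        · rw [if_neg (by omega)]; exact hμM t (by omega)
  · -- validity
    rintro (p | r) hpos
    · dsimp only [Sum.elim_inl]
      have := p.1.isLt
      exact Or.inr (Or.inl ⟨by omega, by omega, hxg⟩)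
    · exact hval r hpos

/-! ### Remainders made of self-sufficient atoms; criterion E -/

/-- **Remainder data from self-sufficient atoms.**  If every charged atom `h ≤ j′` of `ν ≥ 0` has `2h ≥ T`, the point masses
`δ_h` with weights `ν h` are an exact mixture of components valid at `(x, T, j′)` (rule (S)) — the `hrest` datum of
`decAt_of_absorb`. [this work] -/
theorem rest_of_selfSufficient (x T : ℝ) (j' : ℕ) (ν : ℕ → ℝ) (hν0 : ∀ h, 0 ≤ ν h)
    (hself : ∀ h, h ≤ j' → 0 < ν h → T ≤ 2 * (h : ℝ)) :
    ∃ (ρ : Type) (_ : Fintype ρ) (lam g : ρ → ℝ) (lo hi : ρ → ℕ),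
      (∀ r, 0 ≤ lam r) ∧ (∑ r, lam r = ∑ h ∈ Finset.range (j' + 1), ν h) ∧ (∀ r, 0 ≤ g r ∧ g r ≤ 1) ∧
      (∀ r, lo r ≤ hi r) ∧ (∀ r, hi r ≤ j') ∧
      (∀ h, (if h ≤ j' then ν h else 0) = ∑ r, lam r * TP[lo r, hi r, g r, h]) ∧
      (∀ r, 0 < lam r → ValidAt x T j' (lo r) (hi r) (g r)) := by
  refine ⟨Fin (j' + 1), inferInstance, fun i => ν i, fun _ => 1, fun i => i, fun i => i,
    fun i => hν0 i, Fin.sum_univ_eq_sum_range (fun i => ν i) (j' + 1), fun _ => ⟨zero_le_one, le_rfl⟩,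
    fun _ => le_rfl, fun i => Nat.lt_succ_iff.1 i.isLt, fun h => ?_, fun i hi => Or.inl ⟨rfl, Or.inl (hself i (Nat.lt_succ_iff.1 i.isLt) hi)⟩⟩
  have e : ∑ i : Fin (j' + 1), ν (i : ℕ) * TP[(i : ℕ), (i : ℕ), (1 : ℝ), h]
      = ∑ i ∈ Finset.range (j' + 1), ν i * (if h = i then (1 : ℝ) else 0) := by
    rw [Fin.sum_univ_eq_sum_range (fun i => ν i * TP[i, i, (1 : ℝ), h]) (j' + 1)]
    refine Finset.sum_congr rfl fun i _ => ?_
    ring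
  rw [e, sum_indicator ν (j' + 1) h]
  by_cases hh : h ≤ j'
  · rw [if_pos hh, if_pos (Nat.lt_succ_of_le hh)]
  · rw [if_neg hh, if_neg (by omega)]

/-- **No low atom at all.**  If every charged atom of `μ` is self-sufficient at `(T, j′)` (`2h ≥ T` or `h ≥ j′+1`), the point
masses decompose `μ`: DEC(j′). [this work] -/
theorem decAt_of_allSelfSufficient (x : ℝ) (j' M : ℕ) (μ : ℕ → ℝ) (hμ0 : ∀ h, 0 ≤ μ h) (hμM : ∀ h, M < h → μ h = 0)
    (hμ1 : ∑ h ∈ Finset.range (M + 1), μ h = 1)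
    (hself : ∀ h, 0 < μ h → (∑ k ∈ Finset.range (M + 1), (k : ℝ) * μ k) ≤ 2 * (h : ℝ) ∨ j' + 1 ≤ h) :
    DECAt x j' M μ := by
  refine ⟨Fin (M + 1), inferInstance, fun i => μ i, fun _ => 1, fun i => i, fun i => i, fun i => hμ0 i,
    (Fin.sum_univ_eq_sum_range (fun i => μ i) (M + 1)).trans hμ1, fun _ => ⟨zero_le_one, le_rfl⟩, fun _ => le_rfl,
    fun i => Nat.lt_succ_iff.1 i.isLt, fun h => ?_, fun i hi => Or.inl ⟨rfl, hself i hi⟩⟩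
  have e : ∑ i : Fin (M + 1), μ (i : ℕ) * TP[(i : ℕ), (i : ℕ), (1 : ℝ), h]
      = ∑ i ∈ Finset.range (M + 1), μ i * (if h = i then (1 : ℝ) else 0) := by
    rw [Fin.sum_univ_eq_sum_range (fun i => μ i * TP[i, i, (1 : ℝ), h]) (M + 1)]
    refine Finset.sum_congr rfl fun i _ => ?_
    ring
  rw [e, sum_indicator μ (M + 1) h]
  by_cases hh : h < M + 1
  · rw [if_pos hh]
  · rw [if_neg hh]; exact hμM h (by omega)

/-- **CRITERION E ("giants absorb all lows", DEC-TAMP-G50 §3.7 step (1); the inequality `G(j′)`).**  Law `μ` on `{0..M}`, floor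
`0 < x`, layer `j′ < M`, `T` its mean.  If `x·P(low) ≤ (1 − x)·P(giant)`, where the low atoms are `h ≤ j′` with `2h < T` and the
giants are `h ≥ j′ + 1`, then DEC(j′): pair every low atom with the giants at the common gate `ḡ = P_G/(P_G + P_low) ≥ x`
(rule (G)); the remaining atoms `≤ j′` are mids and stand alone. [this work] -/
theorem decAt_of_giantsAbsorbLows (x : ℝ) (j' M : ℕ) (μ : ℕ → ℝ) (hjM : j' < M)
    (hμ0 : ∀ h, 0 ≤ μ h) (hμM : ∀ h, M < h → μ h = 0) (hμ1 : ∑ h ∈ Finset.range (M + 1), μ h = 1)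
    (hx0 : 0 < x)
    (hE : x * ∑ h ∈ Finset.range (j' + 1),
        (if 2 * (h : ℝ) < ∑ k ∈ Finset.range (M + 1), (k : ℝ) * μ k then μ h else 0)
      ≤ (1 - x) * ∑ h ∈ Finset.Ico (j' + 1) (M + 1), μ h) :
    DECAt x j' M μ := by
  set T : ℝ := ∑ k ∈ Finset.range (M + 1), (k : ℝ) * μ k with hT
  set f : ℕ → ℝ := fun h => if 2 * (h : ℝ) < T then μ h else 0 with hf
  obtain ⟨PL, hPL⟩ : ∃ P : ℝ, P = ∑ h ∈ Finset.range (j' + 1), f h := ⟨_, rfl⟩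
  obtain ⟨PG, hPG⟩ : ∃ P : ℝ, P = ∑ h ∈ Finset.Ico (j' + 1) (M + 1), μ h := ⟨_, rfl⟩
  have hf0 : ∀ h, 0 ≤ f h := fun h => by simp only [hf]; split_ifs <;> [exact hμ0 h; exact le_rfl]
  have hfμ : ∀ h, f h ≤ μ h := fun h => by simp only [hf]; split_ifs <;> [exact le_rfl; exact hμ0 h]
  have hPL0 : 0 ≤ PL := by rw [hPL]; exact Finset.sum_nonneg fun h _ => hf0 h
  have hPG0 : 0 ≤ PG := by rw [hPG]; exact Finset.sum_nonneg fun h _ => hμ0 h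
  rw [← hPL, ← hPG] at hE
  rcases hPL0.eq_or_lt with hPL0' | hPLpos
  · -- no low mass: every charged atom is self-sufficient
    refine decAt_of_allSelfSufficient x j' M μ hμ0 hμM hμ1 fun h hh => ?_
    by_cases hj : j' + 1 ≤ h
    · exact Or.inr hj
    · left
      by_contra hlt
      have hfh : 0 < f h := by simp only [hf]; rw [if_pos (not_le.1 hlt)]; exact hh
      have : f h ≤ PL := by
        rw [hPL]
        exact Finset.single_le_sum (fun k _ => hf0 k) (Finset.mem_range.2 (by omega))
      linarith
  · -- giants absorb all low mass at the gate `PG/(PG+PL)`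
    have hden : 0 < PG + PL := by linarith
    have hgx : x ≤ PG / (PG + PL) := by rw [le_div_iff₀ hden]; linarith
    have hg0 : 0 < PG / (PG + PL) := lt_of_lt_of_le hx0 hgx
    have hg1 : PG / (PG + PL) < 1 := by rw [div_lt_one hden]; linarith
    refine decAt_of_absorb x (PG / (PG + PL)) j' M μ f hjM hμ0 hμM hμ1 hgx hg0 hg1 hf0 ?_
      (rest_of_selfSufficient x T j' (fun h => μ h - f h) (fun h => sub_nonneg.2 (hfμ h)) fun h _ hh => ?_)
    · rw [← hPL, ← hPG]
      rw [one_sub_div hden.ne', add_sub_cancel_left, div_mul_eq_mul_div, div_mul_eq_mul_div, mul_comm PL PG]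
    · by_contra hlt
      have : f h = μ h := by simp only [hf]; rw [if_pos (not_le.1 hlt)]
      rw [this, sub_self] at hh
      exact lt_irrefl _ hh

end LawDec

end Quant

end Summit.CriticalPhenomena.PercolationContinuityZ3.Theorems
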